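import Literature.Geometry.Lorentzian.KerrCoordinateEllipsoid
import HarnessLib

/-!
# The trapped collar `r₊ − θ √(M² − a²)` of subextremal Kerr and the collar sphere in `Kerr.data`

(namespace `Literature.Geometry.Lorentzian.Kerr`; companion of `KerrCoordinateEllipsoid.lean`
(`Kerr.spheroidalY`, `Kerr.sectionArea`), `KerrSurfaceGravity.lean` (`Kerr.rPlus`, `Kerr.rMinus`,
`Kerr.sqrt_one_sub_div_sq`) and `KerrData.lean` (`Kerr.data`, `Kerr.slice`).)

Real algebra of the **collar radius** `r_θ = r₊(M, a) − θ √(M² − a²) = M + (1 − θ) √(M² − a²)`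
interpolating between the event horizon (`θ = 0`), the throat `r = M` of the Kerr–Schild slice
(`θ = 1`) and the Cauchy horizon `r₋` (`θ = 2`) (O'Neill 1995, Ch. 2 §2.3–2.5; Wald 1984, §12.3):

* `delta_collarRadius : Δ(r_θ) = −θ(2 − θ)(M² − a²)` for `|a| ≤ M`, hence `Δ(r_θ) < 0` strictly
  inside the collar `0 < θ < 2` on the subextremal family (`delta_collarRadius_neg`: the region
  `r₋ < r < r₊` where the coordinate spheres `{r = const}` are trapped) and `Δ(r_θ) ≤ 0` on the
  closed collar; `M < r_θ ≤ r₊` for `0 ≤ θ < 1` (`lt_collarRadius`, `collarRadius_le_rPlus`);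
* the Boyer–Lindquist area radius on the collar against its horizon value `r₊² + a² = 2 M r₊`:
  `collarRadius_sq_add_sq`, and the two-sided deficit
  `0 ≤ 2 M r₊ − (r_θ² + a²) ≤ 4 θ M √(M² − a²)` for `0 ≤ θ ≤ 1` (`collar_areaRadius_deficit`, also
  in the `χ = 1 − (a/M)²` normalisation `… ≤ 4 θ M² √χ`, and with the depth choice `θ = K d/χ`:
  `collar_deficit_of_depth`, deficit `≤ 4 K M² d/√χ`);
* with `KerrCoordinateEllipsoid.lean`: the coordinate area of the `t* = 0` section of the collar
  sphere `{r = r_θ}` is at least `8π M r₊ − 16π θ M √(M² − a²)` (`collar_sectionArea_ge`);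
* the collar sphere in the datum: `data_h_inner_apply` (the metric of `Kerr.data M a r₁` on
  `v, w` at `y` is `Kerr.bilin` on `(0, v), (0, w)` at `(0, y)`), `spheroidalY_mem_slice`,
  `collarSphere_mem_slice` (`{r = r_θ} ⊆ Kerr.slice a M` for `θ < 1`), and
  `collar_certificate_metric`: on the collar sphere the Gram determinant of the data metric `h` of
  `Kerr.data M a M` on `(∂_ϑ, ∂_φ)` is `≥ (r_θ² + a²)² sin² ϑ` with
  `r_θ² + a² ≥ 2 M r₊ − 4 θ M √(M² − a²)`.

Not here: trappedness of the collar spheres via the null expansions (needs the second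
fundamental form `Kerr.sliceK` of the slice for `a ≠ 0`); the Hausdorff area of the collar sphere
for `h` (area formula); any Sobolev-to-`C¹` perturbation lemma transporting the certificate to
nearby data.

References: O'Neill, *The geometry of Kerr black holes* (1995), Ch. 2 §2.3–2.5 (`ONeill1995`);
Wald, *General Relativity* (1984), §12.3, §12.5 (12.5.21) (`Wald1984GR`); Cook, Living Rev.
Relativ. 3 (2000), §3.2.2 (55) (`Cook2000`).
-/

noncomputable section

open Real Set
open scoped Manifold

namespace Literature.Geometry.Lorentzian

namespace Kerr

/-! ## The collar radius `r_θ = r₊ − θ √(M² − a²)` -/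

/-- The **collar radius** `r_θ = r₊(M,a) − θ √(M² − a²)` (`= r₊ − θ M √(1 − (a/M)²)` for
`0 < M`, `collarRadius_eq`): `θ = 0` is the event horizon, `θ = 1` the throat `r = M`, `θ = 2`
the Cauchy horizon `r₋`. O'Neill 1995, Ch. 2 §2.3. [cite: ONeill1995, Ch. 2 §2.3] -/
def collarRadius (M a θ : ℝ) : ℝ := rPlus M a - θ * √(M ^ 2 - a ^ 2)

/-- `r_θ = M + (1 − θ) √(M² − a²)`. [folklore] -/
theorem collarRadius_eq_add (M a θ : ℝ) :
    collarRadius M a θ = M + (1 - θ) * √(M ^ 2 - a ^ 2) := by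
  unfold collarRadius rPlus
  ring

/-- `r_θ = r₊ − θ M √(1 − (a/M)²)` for `0 < M` (the `χ = 1 − (a/M)²` normalisation). [folklore] -/
theorem collarRadius_eq {M : ℝ} (hM : 0 < M) (a θ : ℝ) :
    collarRadius M a θ = rPlus M a - θ * (M * √(1 - (a / M) ^ 2)) := by
  rw [collarRadius, sqrt_one_sub_div_sq hM, mul_div_cancel₀ _ hM.ne']

/-- `r_0 = r₊`. [folklore] -/
@[simp]
theorem collarRadius_zero (M a : ℝ) : collarRadius M a 0 = rPlus M a := by
  simp [collarRadius]

/-- `r_1 = M` (the throat of the Kerr–Schild slice `Kerr.slice a M`). [folklore] -/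
theorem collarRadius_one (M a : ℝ) : collarRadius M a 1 = M := by
  rw [collarRadius_eq_add]; ring

/-- `r_2 = r₋`. [folklore] -/
theorem collarRadius_two (M a : ℝ) : collarRadius M a 2 = rMinus M a := by
  rw [collarRadius_eq_add, rMinus]; ring

/-- `r_θ ≤ r₊` for `0 ≤ θ`. [folklore] -/
theorem collarRadius_le_rPlus (M a : ℝ) {θ : ℝ} (hθ : 0 ≤ θ) :
    collarRadius M a θ ≤ rPlus M a := by
  unfold collarRadius
  nlinarith [Real.sqrt_nonneg (M ^ 2 - a ^ 2)]

/-- `r_θ < r₊` for `0 < θ` on the subextremal family. [folklore] -/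
theorem collarRadius_lt_rPlus {M a θ : ℝ} (h : IsSubextremal M a) (hθ : 0 < θ) :
    collarRadius M a θ < rPlus M a := by
  have ha : a ^ 2 < M ^ 2 := sq_lt_sq' (abs_lt.1 h).1 (abs_lt.1 h).2
  have hs := Real.sqrt_pos.2 (sub_pos.2 ha)
  unfold collarRadius
  nlinarith

/-- `M ≤ r_θ` for `θ ≤ 1`. [folklore] -/
theorem self_le_collarRadius (M a : ℝ) {θ : ℝ} (hθ : θ ≤ 1) : M ≤ collarRadius M a θ := by
  rw [collarRadius_eq_add]
  nlinarith [Real.sqrt_nonneg (M ^ 2 - a ^ 2)]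

/-- `M < r_θ` for `θ < 1` on the subextremal family: the collar sphere `{r = r_θ}` lies in the
Kerr–Schild slice `Kerr.slice a M = {t* = 0, r > M}`. [folklore] -/
theorem lt_collarRadius {M a θ : ℝ} (h : IsSubextremal M a) (hθ : θ < 1) :
    M < collarRadius M a θ := by
  have ha : a ^ 2 < M ^ 2 := sq_lt_sq' (abs_lt.1 h).1 (abs_lt.1 h).2
  have hs := Real.sqrt_pos.2 (sub_pos.2 ha)
  rw [collarRadius_eq_add]
  nlinarith

/-- `0 < r_θ` for `θ ≤ 1` and `0 < M`. [folklore] -/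
theorem collarRadius_pos {M : ℝ} (hM : 0 < M) (a : ℝ) {θ : ℝ} (hθ : θ ≤ 1) :
    0 < collarRadius M a θ :=
  hM.trans_le (self_le_collarRadius M a hθ)

/-- **`Δ` on the collar**: `Δ(r_θ) = −θ(2 − θ)(M² − a²)` for `|a| ≤ M`
(`Δ = (r − M)² − (M² − a²)`). O'Neill 1995, Ch. 2 §2.3. [cite: ONeill1995, Ch. 2 §2.3] -/
theorem delta_collarRadius {M a : ℝ} (h : |a| ≤ M) (θ : ℝ) :
    delta M a (collarRadius M a θ) = -(θ * (2 - θ) * (M ^ 2 - a ^ 2)) := by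
  have ha : a ^ 2 ≤ M ^ 2 := by nlinarith [sq_abs a, abs_nonneg a]
  have hs : √(M ^ 2 - a ^ 2) ^ 2 = M ^ 2 - a ^ 2 := Real.sq_sqrt (sub_nonneg.2 ha)
  rw [collarRadius_eq_add, delta]
  linear_combination (1 - θ) ^ 2 * hs

/-- `Δ(r_θ) = −θ(2 − θ) M² (1 − (a/M)²)` for `|a| ≤ M`, `0 < M` (the `χ`-normalisation).
[folklore] -/
theorem delta_collarRadius' {M a : ℝ} (h : |a| ≤ M) (hM : 0 < M) (θ : ℝ) :
    delta M a (collarRadius M a θ) = -(θ * (2 - θ) * (M ^ 2 * (1 - (a / M) ^ 2))) := by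
  rw [delta_collarRadius h]
  field_simp

/-- Strictly inside the collar `Δ < 0`: `Δ(r_θ) < 0` for `0 < θ < 2` on the subextremal family
(the coordinate spheres there are trapped; O'Neill 1995, Ch. 2 §2.5). [cite: ONeill1995, Ch. 2 §2.5] -/
theorem delta_collarRadius_neg {M a θ : ℝ} (h : IsSubextremal M a) (h0 : 0 < θ) (h2 : θ < 2) :
    delta M a (collarRadius M a θ) < 0 := by
  have ha : a ^ 2 < M ^ 2 := sq_lt_sq' (abs_lt.1 h).1 (abs_lt.1 h).2
  rw [delta_collarRadius h.le]
  have : 0 < θ * (2 - θ) * (M ^ 2 - a ^ 2) := by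
    have h1 : 0 < θ * (2 - θ) := mul_pos h0 (by linarith)
    exact mul_pos h1 (sub_pos.2 ha)
  linarith

/-- `Δ(r_θ) ≤ 0` on the closed collar `0 ≤ θ ≤ 2`, `|a| ≤ M`. [folklore] -/
theorem delta_collarRadius_nonpos {M a θ : ℝ} (h : |a| ≤ M) (h0 : 0 ≤ θ) (h2 : θ ≤ 2) :
    delta M a (collarRadius M a θ) ≤ 0 := by
  have ha : a ^ 2 ≤ M ^ 2 := by nlinarith [sq_abs a, abs_nonneg a]
  rw [delta_collarRadius h]
  have : 0 ≤ θ * (2 - θ) * (M ^ 2 - a ^ 2) :=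
    mul_nonneg (mul_nonneg h0 (by linarith)) (sub_nonneg.2 ha)
  linarith

/-- `r² + a² = 2 M r + Δ(r)` (definition of `Δ`). [folklore] -/
theorem sq_add_sq_eq_delta (M a r : ℝ) : r ^ 2 + a ^ 2 = 2 * M * r + delta M a r := by
  rw [delta]; ring

/-- **Boyer–Lindquist area radius on the collar**:
`r_θ² + a² = 2 M r₊ − 2 θ M √(M² − a²) − θ(2 − θ)(M² − a²)` for `|a| ≤ M`. [folklore] -/
theorem collarRadius_sq_add_sq {M a : ℝ} (h : |a| ≤ M) (θ : ℝ) :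
    collarRadius M a θ ^ 2 + a ^ 2 =
      2 * M * rPlus M a - 2 * θ * M * √(M ^ 2 - a ^ 2) - θ * (2 - θ) * (M ^ 2 - a ^ 2) := by
  rw [sq_add_sq_eq_delta M a, delta_collarRadius h, collarRadius]
  ring

/-- **Area-radius deficit of the collar, two-sided**: for `|a| ≤ M`, `0 ≤ M` and `0 ≤ θ ≤ 1`,
`0 ≤ 2 M r₊ − (r_θ² + a²) ≤ 4 θ M √(M² − a²)` (`θ(2−θ)(M² − a²) ≤ 2θ M √(M² − a²)` as
`√(M² − a²) ≤ M`). With `4π(r² + a²) ≤ Area(S_r)` inside the hole this is the collar-area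
budget `Area ≥ 8π M r₊ − 16 π θ M² √(1 − (a/M)²)`. [folklore] -/
theorem collar_areaRadius_deficit {M a θ : ℝ} (h : |a| ≤ M) (hM : 0 ≤ M) (h0 : 0 ≤ θ) (h1 : θ ≤ 1) :
    0 ≤ 2 * M * rPlus M a - (collarRadius M a θ ^ 2 + a ^ 2) ∧
      2 * M * rPlus M a - (collarRadius M a θ ^ 2 + a ^ 2) ≤ 4 * θ * M * √(M ^ 2 - a ^ 2) := by
  have ha : a ^ 2 ≤ M ^ 2 := by nlinarith [sq_abs a, abs_nonneg a]
  have hs0 : 0 ≤ √(M ^ 2 - a ^ 2) := Real.sqrt_nonneg _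
  have hsM : √(M ^ 2 - a ^ 2) ≤ M := by
    calc √(M ^ 2 - a ^ 2) ≤ √(M ^ 2) := Real.sqrt_le_sqrt (by nlinarith [sq_nonneg a])
      _ = M := Real.sqrt_sq hM
  have hs : √(M ^ 2 - a ^ 2) ^ 2 = M ^ 2 - a ^ 2 := Real.sq_sqrt (sub_nonneg.2 ha)
  rw [collarRadius_sq_add_sq h]
  constructor
  · nlinarith [mul_nonneg h0 hs0, mul_nonneg (mul_nonneg h0 (by linarith : (0:ℝ) ≤ 2 - θ)) (sub_nonneg.2 ha)]
  · nlinarith [mul_nonneg h0 hs0, mul_nonneg (mul_nonneg h0 hs0) (sub_nonneg.2 hsM),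
      mul_nonneg (mul_nonneg h0 h0) (sub_nonneg.2 ha)]

/-- The same deficit in the `χ`-normalisation: `2 M r₊ − (r_θ² + a²) ≤ 4 θ M² √(1 − (a/M)²)`
for `|a| ≤ M`, `0 < M`, `0 ≤ θ ≤ 1`. [folklore] -/
theorem collar_areaRadius_deficit' {M a θ : ℝ} (h : |a| ≤ M) (hM : 0 < M) (h0 : 0 ≤ θ) (h1 : θ ≤ 1) :
    2 * M * rPlus M a - (collarRadius M a θ ^ 2 + a ^ 2) ≤
      4 * θ * M ^ 2 * √(1 - (a / M) ^ 2) := by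
  have := (collar_areaRadius_deficit h hM.le h0 h1).2
  rw [sqrt_one_sub_div_sq hM]
  calc _ ≤ 4 * θ * M * √(M ^ 2 - a ^ 2) := this
    _ = 4 * θ * M ^ 2 * (√(M ^ 2 - a ^ 2) / M) := by field_simp

/-- **Choice of the collar depth.** With `θ = K d / χ` (`χ = 1 − (a/M)²`, `K d ≤ χ/2` so that
`θ ≤ 1/2`) the deficit is `≤ 4 K M² d / √χ = 4 K M² χ^{-1/2} d` (linear in `d`, at the price
`χ^{-1/2}`). Pure bookkeeping. [folklore] -/
theorem collar_deficit_of_depth {M a K d : ℝ} (h : IsSubextremal M a) (hK : 0 ≤ K) (hd : 0 ≤ d)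
    (hKd : K * d ≤ (1 - (a / M) ^ 2) / 2) :
    2 * M * rPlus M a - (collarRadius M a (K * d / (1 - (a / M) ^ 2)) ^ 2 + a ^ 2) ≤
      4 * K * M ^ 2 * d / √(1 - (a / M) ^ 2) := by
  have hM := h.pos
  have hχ0 : 0 < 1 - (a / M) ^ 2 := by
    have ha : a ^ 2 < M ^ 2 := sq_lt_sq' (abs_lt.1 h).1 (abs_lt.1 h).2
    rwa [div_pow, sub_pos, div_lt_one (by positivity)]
  have hθ0 : 0 ≤ K * d / (1 - (a / M) ^ 2) := div_nonneg (mul_nonneg hK hd) hχ0.le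
  have hθ1 : K * d / (1 - (a / M) ^ 2) ≤ 1 := by
    rw [div_le_one hχ0]; linarith
  have hsq : 0 < √(1 - (a / M) ^ 2) := Real.sqrt_pos.2 hχ0
  calc _ ≤ 4 * (K * d / (1 - (a / M) ^ 2)) * M ^ 2 * √(1 - (a / M) ^ 2) :=
        collar_areaRadius_deficit' h.le hM hθ0 hθ1
    _ = 4 * K * M ^ 2 * d / √(1 - (a / M) ^ 2) := by
        rw [eq_div_iff hsq.ne']
        rw [show 4 * (K * d / (1 - (a / M) ^ 2)) * M ^ 2 * √(1 - (a / M) ^ 2) * √(1 - (a / M) ^ 2)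
            = 4 * K * d * M ^ 2 * (√(1 - (a / M) ^ 2) * √(1 - (a / M) ^ 2)) / (1 - (a / M) ^ 2) by ring,
          Real.mul_self_sqrt hχ0.le, mul_div_cancel_right₀ _ hχ0.ne']
        ring

/-- **Normalised Kerr horizon area**: `(r₊² + a²)/2 = M r₊`, i.e. `A_Kerr/8π = M r₊(M,a)` with
`A_Kerr = 4π(r₊² + a²)` (Wald 1984, (12.5.21)); restated from `Kerr.rPlus_sq_add_sq`.
[cite: Wald1984GR, §12.5 eq. (12.5.21)] -/
theorem horizon_areaRadius {M a : ℝ} (h : |a| ≤ M) :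
    (rPlus M a ^ 2 + a ^ 2) / 2 = M * rPlus M a := by
  rw [rPlus_sq_add_sq h]; ring

/-! ## The `t* = 0` section of the collar sphere `{r = r_θ}` -/

/-- **Collar area budget (exact Kerr, integrated form).** For subextremal `(M, a)` and
`0 ≤ θ ≤ 1`, the `t* = 0` section of the collar sphere `{r = r_θ}` has coordinate area at least
`8π M r₊ − 16 π θ M √(M² − a²)` (`= A_Kerr − 16π θ M² √(1 − (a/M)²)`). [folklore] -/
theorem collar_sectionArea_ge {M a θ : ℝ} (h : IsSubextremal M a) (h0 : 0 ≤ θ) (h1 : θ ≤ 1) :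
    8 * π * (M * rPlus M a) - 16 * π * θ * M * √(M ^ 2 - a ^ 2) ≤
      sectionArea M a (collarRadius M a θ) := by
  have hA := le_sectionArea M a (collarRadius M a θ)
    (delta_collarRadius_nonpos h.le h0 (by linarith))
  have hB := (collar_areaRadius_deficit h.le h.pos.le h0 h1).2
  nlinarith [Real.pi_pos]

/-! ## The collar sphere in the Kerr–Schild datum `Kerr.data M a M` -/

/-- The data metric of `Kerr.data M a r₁` on tangent vectors `v, w` at `y` **is** the Kerr–Schild
form on `(0, v), (0, w)` at `(0, y)`: `h = ι^* g` with `dι v = (0, v)` (`Kerr.data_h_inner`,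
`Kerr.mfderiv_sliceEmbed`). Cook 2000, §3.2.2 (55). [cite: Cook2000, §3.2.2 (55)] -/
theorem data_h_inner_apply [Facts] [SliceFacts] (M a r₁ : ℝ) (hM : 0 ≤ M)
    (y : slice a r₁) (v w : E3) :
    (data M a r₁ hM).h.inner y v w =
      bilin M a (E4.ofTimeSpace 0 (y : E3)) (E4.spaceEmbed v) (E4.spaceEmbed w) := by
  rw [data_h_inner, PseudoRiemannianMetric.inducedBilin_apply, mfderiv_sliceEmbed,
    smoothMetric_val, coe_sliceEmbed]
  rfl

/-- The ellipsoid `{r = r₀}` lies in the slice `Kerr.slice a r₁` as soon as `max r₁ 0 < r₀`.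
[folklore] -/
theorem spheroidalY_mem_slice (a : ℝ) {r₀ r₁ : ℝ} (h₁ : r₁ < r₀) (h₀ : 0 < r₀) (ϑ φ : ℝ) :
    spheroidalY a r₀ ϑ φ ∈ slice a r₁ := by
  rw [mem_slice, radius_spheroidalY a h₀]
  exact max_lt h₁ h₀

/-- **The collar sphere lies in the Kerr–Schild slice `Kerr.slice a M = {t* = 0, r > M}`** for
subextremal `(M, a)` and `θ < 1` (in particular `θ ≤ 1/2`). [folklore] -/
theorem collarSphere_mem_slice {M a θ : ℝ} (h : IsSubextremal M a) (hθ : θ < 1) (ϑ φ : ℝ) :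
    spheroidalY a (collarRadius M a θ) ϑ φ ∈ slice a M :=
  spheroidalY_mem_slice a (lt_collarRadius h hθ) (h.pos.trans (lt_collarRadius h hθ)) ϑ φ

/-- **Collar certificate, metric half (exact Kerr).** For subextremal `(M, a)`, `0 ≤ θ < 1`, at
every point `y(ϑ, φ)` of the collar sphere `{t* = 0, r = r_θ}` the Gram determinant of the data
metric `h` of `Kerr.data M a M` on the coordinate frame `(∂_ϑ, ∂_φ)` is at least
`(r_θ² + a²)² sin² ϑ`, and `r_θ² + a² ≥ 2 M r₊ − 4 θ M √(M² − a²)`: the area element of the collar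
sphere dominates that of a round sphere of area `4π(r_θ² + a²) ≥ 8π M r₊ − 16 π θ M √(M² − a²)`.
(Integrating the area element for the Hausdorff area of `Volume.lean`, `area h {r = r_θ} ≥
4π(r_θ² + a²)`, and trappedness of the sphere via `Kerr.sliceK` are not attempted here.) [folklore] -/
theorem collar_certificate_metric [Facts] [SliceFacts] {M a θ : ℝ}
    (h : IsSubextremal M a) (h0 : 0 ≤ θ) (h1 : θ < 1) (ϑ φ : ℝ) :
    let y : slice a M := ⟨spheroidalY a (collarRadius M a θ) ϑ φ, collarSphere_mem_slice h h1 ϑ φ⟩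
    let eϑ : E3 := spheroidalDTheta a (collarRadius M a θ) ϑ φ
    let eφ : E3 := spheroidalDPhi a (collarRadius M a θ) ϑ φ
    (collarRadius M a θ ^ 2 + a ^ 2) ^ 2 * sin ϑ ^ 2 ≤
        (data M a M h.pos.le).h.inner y eϑ eϑ * (data M a M h.pos.le).h.inner y eφ eφ -
          (data M a M h.pos.le).h.inner y eϑ eφ ^ 2 ∧
      2 * M * rPlus M a - 4 * θ * M * √(M ^ 2 - a ^ 2) ≤ collarRadius M a θ ^ 2 + a ^ 2 := by
  refine ⟨?_, ?_⟩
  · simp only [data_h_inner_apply]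
    exact round_le_gram_spheroidal M a (collarRadius_pos h.pos a h1.le)
      (delta_collarRadius_nonpos h.le h0 (by linarith)) ϑ φ
  · linarith [(collar_areaRadius_deficit h.le h.pos.le h0 h1.le).2]

end Kerr

end Literature.Geometry.Lorentzian
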